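import Summits.QuantumFields.BalabanUV.T4Continuum.Support.ScalarBlockPoincare

/-!
# T⁴ programme, spine node NE2 (U1a), tier B support row B4.c — THE `U = 1` SCALAR AVERAGED PROPAGATOR
# `G′ = (Δ + a′·Π′)⁻¹`: coercivity `Δ + a′Π′ ≥ γ′(Δ + 1)`, `‖G′‖ ≤ γ′⁻¹`, and the one-derivative bounds
# `‖∂_νG′‖, ‖G′∂_ν^*‖ ≤ γ′^{−1/2}`, `‖∂_νG′∂_μ^*‖ ≤ 1`, `‖∂G′∂^*‖ ≤ 1`, all UNIFORM in `η = 1/n`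

NE2 formalisation swarm `b2b-balaban-t4-ne2-formalise-*`, leaf 09, file 2 (support row B4.c).  The gauge term of Bałaban's
background operator ([Balaban1985BackgroundPropagators] = [B9] (3.26) p.395 «Δ_a = Δ + DRD* + Q*aQ») is built from the scalar
propagator `G′ = (Δ′_a)⁻¹`, (3.24) p.394 «Δ′_a = Δ^η_U + Q′*aQ′» (single region, so one weight `a′`), through the projection
(3.25) «R = I − G′Q′*(Q′G′²Q′*)⁻¹Q′G′».  Tier-B row B4.b (leaf-05, CLAIMS.log l.5475) factors `DRD* = DD* − ZᴴNZ`,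
`Z = Q′G′D*`, `N = (Q′G′²Q′*)⁻¹`, and takes as `U = 1` DATA: the coercivity constant `γ′` of `Δ′_a`, the bound «‖D G′‖² ≤ ‖G′‖
by positivity», and `n₁ = sup ‖N‖`.  THIS FILE proves the first two as THEOREMS for the typed `U = 1` objects of the tree
(`B5Action121.LapS/sdiff/GradOp`, `B5Block118.QsOp`; `Π′ = n^d·Q′ᴴQ′ = Q′*Q′` of file 1 `Support/ScalarBlockPoincare`):

 * §1 `DeltaPs n M a′ = LapS + a′•Π′` (= Δ′_a at `U = 1`, `Q′* = n^dQ′ᴴ`), Hermitian, its quadratic form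
   `⟨f, Δ′f⟩ = Σ_ν nsq (∂_νf) + a′·nsq (Π′f)` (REAL);
 * §2 **COERCIVITY** from the block Poincaré inequality of file 1: `γ′·(Σ_ν nsq (∂_νf) + nsq f) ≤ ⟨f, Δ′f⟩`,
   `γ′ = gammaPs d a′ = (1 + max (2/a′) (8d))⁻¹` — EXPLICIT, depending on `d, a′` only; hence `Δ′` is positive definite and
   invertible (`isUnit_det_DeltaPs`), `Gps := Δ′⁻¹`, `Δ′·G′ = 1 = G′·Δ′`, `G′` Hermitian;
 * §3 **OPERATOR-NORM BOUNDS by positivity (no Fourier analysis)**: `opNorm_le_of_nsq_le_rect` (rectangular `‖A‖ ≤ C` from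
   vector bounds), **`opNorm_Gps_le`** `‖G′‖ ≤ γ′⁻¹`, **`opNorm_sdiff_mul_Gps_le`** `‖∂_νG′‖ ≤ √(γ′⁻¹)`,
   **`opNorm_Gps_mul_sdiffH_le`**, **`opNorm_GradOp_mul_Gps_le`** `‖∂G′‖ ≤ √(γ′⁻¹)` (`∂ = GradOp`: 0-forms → 1-forms),
   **`opNorm_sdiff_Gps_sdiffH_le`** `‖∂_νG′∂_μ^*‖ ≤ 1`, **`opNorm_GradOp_Gps_GradOpH_le`** `‖∂G′∂^*‖ ≤ 1` — the `U = 1` case of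
   leaf-05's «‖D_UG′‖² ≤ ‖G′‖».  The third datum `n₁` (a k-uniform bound on `‖(Q′G′²Q′*)⁻¹‖`) is NOT proved here (row B4.c
   stretch goal; the algebraic half `Q′G′²Q′* ≥ (Q′G′Q′*)²` and the missing lower bound on `Q′G′Q′*` are recorded in the swarm table).

HONEST FRAMING (T4-DAG p. 1).  [folklore] finite-dimensional positivity arguments about the cell's typed `U = 1` objects;
statements / constants OURS; nothing printed is a hypothesis.  `U = 1`, FIXED FINITE torus, scalar layer, operator norm; a
SUPPORT input of row B4.b, NOT B4, NOT [B9] (3.23)–(3.26) as printed; NE2 NOT proved; spine 0/9 unchanged; NOT infinite volume /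
mass gap / Clay / summit progress.  HONEST DEPENDENCY: continuum YM on T⁴ ⇐ BetaPertH ∧ nine spine estimates (0/9 proved);
BetaPertH ⇐ (D1) ∧ (D4) ∧ CAP+tail; G-an2-4 gates asym, D1 and NE2/3/4.  ABSOLUTE RULE kept; zero sorries.
-/

noncomputable section

open scoped BigOperators ComplexConjugate ComplexOrder Matrix Matrix.Norms.L2Operator
open Finset

namespace Summit.QuantumFields.BalabanUV.T4Continuum.ScalarAveragedPropagator

open Literature.MathematicalPhysics.QuantumFieldTheory.Balaban1983to89.B5Prop11Plancherel
open Literature.MathematicalPhysics.QuantumFieldTheory.Balaban1983to89.B5Prop11Lower (nsq nsq_nonneg star_dotProduct_self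
  norm_star_dotProduct_le)
open Literature.MathematicalPhysics.QuantumFieldTheory.Balaban1983to89.B5Action121 (sdiff LapS GradOp form_gram_rect)
open Literature.MathematicalPhysics.QuantumFieldTheory.Balaban1983to89.B5Block118 (QsOp)
open Summit.QuantumFields.BalabanUV.T4Continuum.ScalarBlockPoincare

variable {d : ℕ}

/-! ## §0 Two `ℓ²` tools -/

section Tools

variable {m k : Type*} [Fintype m] [Fintype k] [DecidableEq k]

/-- operator-norm bound for a RECTANGULAR matrix from a quadratic bound on vectors: if `nsq (Av) ≤ C²·nsq v` for all `v` then
`‖A‖ ≤ C`. [folklore] -/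
theorem opNorm_le_of_nsq_le_rect (A : Matrix m k ℂ) {C : ℝ} (hC : 0 ≤ C) (h : ∀ v : k → ℂ, nsq (A *ᵥ v) ≤ C ^ 2 * nsq v) :
    ‖A‖ ≤ C := by
  rw [Matrix.l2_opNorm_def]
  refine ContinuousLinearMap.opNorm_le_bound _ hC fun x => ?_
  have e1 : ‖((Matrix.toEuclideanLin (𝕜 := ℂ) (m := m) (n := k)).trans LinearMap.toContinuousLinearMap A) x‖ ^ 2
      = nsq (A *ᵥ x.ofLp) := by
    rw [EuclideanSpace.norm_sq_eq]; rfl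
  have e2 : ‖x‖ ^ 2 = nsq x.ofLp := by rw [EuclideanSpace.norm_sq_eq]; rfl
  have h3 := h x.ofLp
  rw [← e1, ← e2, ← mul_pow] at h3
  exact (pow_le_pow_iff_left₀ (norm_nonneg _) (mul_nonneg hC (norm_nonneg _)) two_ne_zero).mp h3

omit [DecidableEq k] in
/-- `re (u^* v) ≤ √(nsq u)·√(nsq v)`. [folklore] -/
theorem re_star_dotProduct_le (u v : m → ℂ) : (star u ⬝ᵥ v).re ≤ Real.sqrt (nsq u) * Real.sqrt (nsq v) :=
  (Complex.re_le_norm _).trans (norm_star_dotProduct_le u v)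

end Tools

/-! ## §1 The operator `Δ′ = Δ + a′Π′` and its quadratic form -/

section Operator

variable (n : ℕ) [NeZero n] (M : Fin d → ℕ) [hM : ∀ μ, NeZero (M μ)] (a' : ℝ)

/-- **`Δ′_a` AT `U = 1`** on 0-forms of the fine torus: `DeltaPs = Δ + a′·Π′`, `Δ = Σ_ν ∂_ν^*∂_ν` with lattice factor `n = η⁻¹`
(`B5Action121.LapS … (n : ℂ)`), `Π′ = n^d Q′ᴴQ′ = Q′*Q′` (`ScalarBlockPoincare.PiS`).  The `U = 1`, single-region case of
[Balaban1985BackgroundPropagators] (3.24) p.394 «Δ′_a = Δ^η_U + Q′*aQ′» (typed object; no printed claim is used). [folklore] -/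
def DeltaPs : Matrix (Tor (fine n M)) (Tor (fine n M)) ℂ := LapS (fine n M) (n : ℂ) + (a' : ℂ) • PiS n M

/-- the coercivity constant `γ′ = (1 + max (2/a′) (8d))⁻¹`. [folklore] -/
def gammaPs (d : ℕ) (a' : ℝ) : ℝ := (1 + max (2 / a') (8 * d))⁻¹

/-- the Dirichlet form `Σ_ν nsq (∂_ν f)`. [folklore] -/
def dirichlet (f : Tor (fine n M) → ℂ) : ℝ := ∑ ν, nsq (sdiff (fine n M) (n : ℂ) ν *ᵥ f)

/-- `Σ_ν nsq (∂_νf) ≥ 0`. [folklore] -/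
theorem dirichlet_nonneg (f : Tor (fine n M) → ℂ) : 0 ≤ dirichlet n M f := Finset.sum_nonneg fun _ _ => nsq_nonneg _

/-- `nsq (∂_νf) ≤ Σ_μ nsq (∂_μf)`. [folklore] -/
theorem nsq_sdiff_le_dirichlet (ν : Fin d) (f : Tor (fine n M) → ℂ) : nsq (sdiff (fine n M) (n : ℂ) ν *ᵥ f) ≤ dirichlet n M f :=
  Finset.single_le_sum (f := fun μ => nsq (sdiff (fine n M) (n : ℂ) μ *ᵥ f)) (fun _ _ => nsq_nonneg _) (Finset.mem_univ ν)

omit [NeZero n] in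
/-- `Π′` is Hermitian. [folklore] -/
theorem PiS_isHermitian : (PiS n M).IsHermitian := by
  unfold Matrix.IsHermitian PiS
  rw [Matrix.conjTranspose_smul, Matrix.conjTranspose_mul, Matrix.conjTranspose_conjTranspose]
  congr 1
  rw [Complex.star_def, ← Complex.ofReal_natCast, ← Complex.ofReal_pow, Complex.conj_ofReal]

/-- `Δ` is Hermitian. [folklore] -/
theorem LapS_isHermitian' : (LapS (fine n M) (n : ℂ)).IsHermitian := by
  unfold Matrix.IsHermitian LapS
  rw [Matrix.conjTranspose_sum]
  exact Finset.sum_congr rfl fun ν _ => by rw [Matrix.conjTranspose_mul, Matrix.conjTranspose_conjTranspose]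

/-- `Δ′` is Hermitian. [folklore] -/
theorem DeltaPs_isHermitian : (DeltaPs n M a').IsHermitian := by
  unfold DeltaPs
  refine (LapS_isHermitian' n M).add ((PiS_isHermitian n M).smul ?_)
  simp [IsSelfAdjoint, Complex.conj_ofReal]

/-- **the quadratic form of `Δ′`**: `⟨f, Δ′f⟩ = Σ_ν nsq (∂_νf) + a′·nsq (Π′f)` (a real number). [folklore] -/
theorem form_DeltaPs (f : Tor (fine n M) → ℂ) :
    star f ⬝ᵥ (DeltaPs n M a' *ᵥ f) = (((dirichlet n M f + a' * nsq (PiS n M *ᵥ f)) : ℝ) : ℂ) := by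
  rw [DeltaPs, Matrix.add_mulVec, dotProduct_add, Matrix.smul_mulVec, dotProduct_smul, form_LapS_eq, form_PiS, smul_eq_mul,
    dirichlet]
  push_cast; ring

/-- its real part. [folklore] -/
theorem re_form_DeltaPs (f : Tor (fine n M) → ℂ) :
    (star f ⬝ᵥ (DeltaPs n M a' *ᵥ f)).re = dirichlet n M f + a' * nsq (PiS n M *ᵥ f) := by
  rw [form_DeltaPs, Complex.ofReal_re]

/-- **THE SCALAR AVERAGED PROPAGATOR `G′ = (Δ + a′Π′)⁻¹` AT `U = 1`** (the `U = 1` case of [B9] (3.25) «G′ = G′(U) = (Δ′_a)⁻¹»,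
typed object). [folklore] -/
def Gps : Matrix (Tor (fine n M)) (Tor (fine n M)) ℂ := (DeltaPs n M a')⁻¹

/-- `G′` is Hermitian. [folklore] -/
theorem Gps_isHermitian : (Gps n M a').IsHermitian := (DeltaPs_isHermitian n M a').inv

end Operator

/-! ## §2 Coercivity, invertibility, the propagator `G′` -/

section Coercive

variable (n : ℕ) [NeZero n] (M : Fin d → ℕ) [hM : ∀ μ, NeZero (M μ)] {a' : ℝ}

omit hM in
/-- `0 < γ′ ≤ 1`. [folklore] -/
theorem gammaPs_pos : 0 < gammaPs d a' ∧ gammaPs d a' ≤ 1 := by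
  have hm : 0 ≤ max (2 / a') (8 * d) := le_max_of_le_right (by positivity)
  refine ⟨by unfold gammaPs; positivity, ?_⟩
  unfold gammaPs
  exact inv_le_one_of_one_le₀ (by linarith)

/-- **COERCIVITY OF `Δ′ = Δ + a′Π′` AT `U = 1`**: `γ′·(Σ_ν nsq (∂_νf) + nsq f) ≤ Σ_ν nsq (∂_νf) + a′·nsq (Π′f) = ⟨f, Δ′f⟩`,
`γ′ = (1 + max (2/a′) (8d))⁻¹`, UNIFORMLY in `n = η⁻¹` and the torus — from `nsq f ≤ 2nsq (Π′f) + 2nsq (f − Π′f)` and the block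
Poincaré inequality `nsq (f − Π′f) ≤ 4d·Σ_ν nsq (∂_νf)`. [folklore] -/
theorem coercive (ha' : 0 < a') (f : Tor (fine n M) → ℂ) :
    gammaPs d a' * (dirichlet n M f + nsq f) ≤ dirichlet n M f + a' * nsq (PiS n M *ᵥ f) := by
  set L := dirichlet n M f with hL
  set P := nsq (PiS n M *ᵥ f) with hP
  set m := max (2 / a') (8 * d) with hm
  have hL0 : 0 ≤ L := dirichlet_nonneg n M f
  have hP0 : 0 ≤ P := nsq_nonneg _
  have hm0 : 0 ≤ m := le_max_of_le_right (by positivity)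
  -- `nsq f ≤ 2P + 8dL`
  have h1 : nsq f ≤ 2 * P + 2 * (4 * d * L) := by
    have e : f = PiS n M *ᵥ f + (f - PiS n M *ᵥ f) := by abel
    have h := nsq_add_le (PiS n M *ᵥ f) (f - PiS n M *ᵥ f)
    rw [← e] at h
    have hpoinc : nsq (f - PiS n M *ᵥ f) ≤ 4 * d * L := nsq_sub_PiS_le n M f
    linarith
  -- `2P ≤ m·a′P`, `8dL ≤ m·L`
  have haP : 0 ≤ a' * P := mul_nonneg ha'.le hP0
  have h2 : 2 * P ≤ m * (a' * P) := by
    have : 2 * P = (2 / a') * (a' * P) := by field_simp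
    rw [this]
    exact mul_le_mul_of_nonneg_right (le_max_left _ _) haP
  have h3 : 2 * (4 * d * L) ≤ m * L := by
    have : 2 * (4 * (d : ℝ) * L) = (8 * d) * L := by ring
    rw [this]
    exact mul_le_mul_of_nonneg_right (le_max_right _ _) hL0
  have e5 : (1 + m) * (L + a' * P) = L + a' * P + (m * L + m * (a' * P)) := by ring
  have h4 : L + nsq f ≤ (1 + m) * (L + a' * P) := by rw [e5]; linarith
  have h1m : 0 < 1 + m := by linarith
  unfold gammaPs
  rw [← hm, inv_mul_le_iff₀ h1m]
  exact h4

/-- hence `γ′·nsq f ≤ re ⟨f, Δ′f⟩`. [folklore] -/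
theorem re_form_DeltaPs_ge (ha' : 0 < a') (f : Tor (fine n M) → ℂ) :
    gammaPs d a' * nsq f ≤ (star f ⬝ᵥ (DeltaPs n M a' *ᵥ f)).re := by
  rw [re_form_DeltaPs]
  have h := coercive n M ha' f
  have hγ := (gammaPs_pos (d := d) (a' := a')).1
  nlinarith [dirichlet_nonneg n M f]

/-- and `γ′·Σ_ν nsq (∂_νf) ≤ re ⟨f, Δ′f⟩` (indeed `Σ_ν nsq (∂_νf) ≤ re ⟨f, Δ′f⟩`). [folklore] -/
theorem dirichlet_le_re_form (ha' : 0 < a') (f : Tor (fine n M) → ℂ) :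
    dirichlet n M f ≤ (star f ⬝ᵥ (DeltaPs n M a' *ᵥ f)).re := by
  rw [re_form_DeltaPs]
  nlinarith [nsq_nonneg (PiS n M *ᵥ f), ha'.le]

/-- **`Δ′` is positive definite** (uniformly: `Δ′ ≥ γ′·1`). [folklore] -/
theorem DeltaPs_posDef (ha' : 0 < a') : (DeltaPs n M a').PosDef := by
  refine Matrix.PosDef.of_dotProduct_mulVec_pos (DeltaPs_isHermitian n M a') fun x hx => ?_
  rw [form_DeltaPs, Complex.zero_lt_real]
  have hγ := (gammaPs_pos (d := d) (a' := a')).1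
  have hx' : 0 < nsq x := by
    obtain ⟨i, hi⟩ := Function.ne_iff.mp hx
    have h1 : 0 < ‖x i‖ ^ 2 := pow_pos (norm_pos_iff.mpr hi) 2
    have h2 : ‖x i‖ ^ 2 ≤ nsq x := Finset.single_le_sum (f := fun j => ‖x j‖ ^ 2) (fun j _ => sq_nonneg _) (Finset.mem_univ i)
    exact lt_of_lt_of_le h1 h2
  have h := coercive n M ha' x
  nlinarith [dirichlet_nonneg n M x]

/-- `Δ′` is invertible. [folklore] -/
theorem isUnit_det_DeltaPs (ha' : 0 < a') : IsUnit (DeltaPs n M a').det :=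
  (Matrix.isUnit_iff_isUnit_det _).mp (DeltaPs_posDef n M ha').isUnit

/-- `Δ′G′ = 1`. [folklore] -/
theorem DeltaPs_mul_Gps (ha' : 0 < a') : DeltaPs n M a' * Gps n M a' = 1 := Matrix.mul_nonsing_inv _ (isUnit_det_DeltaPs n M ha')

/-- `G′Δ′ = 1`. [folklore] -/
theorem Gps_mul_DeltaPs (ha' : 0 < a') : Gps n M a' * DeltaPs n M a' = 1 := Matrix.nonsing_inv_mul _ (isUnit_det_DeltaPs n M ha')

/-- the basic positivity identity: `re ⟨G′x, x⟩ = re ⟨G′x, Δ′(G′x)⟩ ≥ γ′·nsq (G′x)` and `≥ Σ_ν nsq (∂_ν G′x)`. [folklore] -/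
theorem re_form_Gps (ha' : 0 < a') (x : Tor (fine n M) → ℂ) :
    (star (Gps n M a' *ᵥ x) ⬝ᵥ x).re = dirichlet n M (Gps n M a' *ᵥ x) + a' * nsq (PiS n M *ᵥ (Gps n M a' *ᵥ x)) := by
  have h := re_form_DeltaPs n M a' (Gps n M a' *ᵥ x)
  rwa [Matrix.mulVec_mulVec, DeltaPs_mul_Gps n M ha', Matrix.one_mulVec] at h

end Coercive

/-! ## §3 Operator-norm bounds by positivity -/

section Bounds

variable (n : ℕ) [NeZero n] (M : Fin d → ℕ) [hM : ∀ μ, NeZero (M μ)] {a' : ℝ}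

/-- `nsq (G′x) ≤ γ′⁻²·nsq x`. [folklore] -/
theorem nsq_Gps_mulVec_le (ha' : 0 < a') (x : Tor (fine n M) → ℂ) :
    nsq (Gps n M a' *ᵥ x) ≤ ((gammaPs d a')⁻¹) ^ 2 * nsq x := by
  have hγ := (gammaPs_pos (d := d) (a' := a')).1
  set g := Gps n M a' *ᵥ x with hg
  have h1 : gammaPs d a' * nsq g ≤ (star g ⬝ᵥ x).re := by
    rw [re_form_Gps n M ha']
    have h := coercive n M ha' g
    nlinarith [dirichlet_nonneg n M g]
  have h2 : (star g ⬝ᵥ x).re ≤ Real.sqrt (nsq g) * Real.sqrt (nsq x) := re_star_dotProduct_le g x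
  have hsg : Real.sqrt (nsq g) ^ 2 = nsq g := Real.sq_sqrt (nsq_nonneg _)
  have hsx : Real.sqrt (nsq x) ^ 2 = nsq x := Real.sq_sqrt (nsq_nonneg _)
  have h3 : gammaPs d a' * Real.sqrt (nsq g) ≤ Real.sqrt (nsq x) := by
    by_cases hz : Real.sqrt (nsq g) = 0
    · rw [hz, mul_zero]; exact Real.sqrt_nonneg _
    · have hpos : 0 < Real.sqrt (nsq g) := lt_of_le_of_ne (Real.sqrt_nonneg _) (Ne.symm hz)
      have h4 : gammaPs d a' * Real.sqrt (nsq g) * Real.sqrt (nsq g) ≤ Real.sqrt (nsq x) * Real.sqrt (nsq g) := by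
        nlinarith [h1, h2, hsg]
      exact le_of_mul_le_mul_right h4 hpos
  have h5 : Real.sqrt (nsq g) ≤ (gammaPs d a')⁻¹ * Real.sqrt (nsq x) := by
    rw [← div_eq_inv_mul, le_div_iff₀ hγ]; linarith
  calc nsq g = Real.sqrt (nsq g) ^ 2 := hsg.symm
    _ ≤ ((gammaPs d a')⁻¹ * Real.sqrt (nsq x)) ^ 2 := pow_le_pow_left₀ (Real.sqrt_nonneg _) h5 2
    _ = ((gammaPs d a')⁻¹) ^ 2 * nsq x := by rw [mul_pow, hsx]

/-- **`‖G′‖ ≤ γ′⁻¹`**, uniformly in `η` and the torus. [folklore] -/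
theorem opNorm_Gps_le (ha' : 0 < a') : ‖Gps n M a'‖ ≤ (gammaPs d a')⁻¹ :=
  opNorm_le_of_nsq_le_rect _ (inv_nonneg.mpr (gammaPs_pos (d := d) (a' := a')).1.le) (nsq_Gps_mulVec_le n M ha')

/-- `Σ_ν nsq (∂_ν G′x) ≤ γ′⁻¹·nsq x` (one derivative of `G′` costs `√‖G′‖`). [folklore] -/
theorem dirichlet_Gps_mulVec_le (ha' : 0 < a') (x : Tor (fine n M) → ℂ) :
    dirichlet n M (Gps n M a' *ᵥ x) ≤ (gammaPs d a')⁻¹ * nsq x := by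
  have hγ := (gammaPs_pos (d := d) (a' := a')).1
  set g := Gps n M a' *ᵥ x with hg
  have h1 : dirichlet n M g ≤ (star g ⬝ᵥ x).re := by
    rw [re_form_Gps n M ha']; nlinarith [nsq_nonneg (PiS n M *ᵥ g), dirichlet_nonneg n M g]
  have h2 : (star g ⬝ᵥ x).re ≤ Real.sqrt (nsq g) * Real.sqrt (nsq x) := re_star_dotProduct_le g x
  have h3 : Real.sqrt (nsq g) ≤ (gammaPs d a')⁻¹ * Real.sqrt (nsq x) := by
    have h := nsq_Gps_mulVec_le n M ha' x
    rw [← hg] at h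
    calc Real.sqrt (nsq g) ≤ Real.sqrt (((gammaPs d a')⁻¹) ^ 2 * nsq x) := Real.sqrt_le_sqrt h
      _ = (gammaPs d a')⁻¹ * Real.sqrt (nsq x) := by
          rw [Real.sqrt_mul (sq_nonneg _), Real.sqrt_sq (inv_nonneg.mpr hγ.le)]
  have hsx : Real.sqrt (nsq x) * Real.sqrt (nsq x) = nsq x := Real.mul_self_sqrt (nsq_nonneg _)
  calc dirichlet n M g ≤ Real.sqrt (nsq g) * Real.sqrt (nsq x) := h1.trans h2
    _ ≤ ((gammaPs d a')⁻¹ * Real.sqrt (nsq x)) * Real.sqrt (nsq x) := mul_le_mul_of_nonneg_right h3 (Real.sqrt_nonneg _)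
    _ = (gammaPs d a')⁻¹ * nsq x := by rw [mul_assoc, hsx]

/-- **`‖∂_ν G′‖ ≤ √(γ′⁻¹)`**. [folklore] -/
theorem opNorm_sdiff_mul_Gps_le (ha' : 0 < a') (ν : Fin d) :
    ‖sdiff (fine n M) (n : ℂ) ν * Gps n M a'‖ ≤ Real.sqrt ((gammaPs d a')⁻¹) := by
  refine opNorm_le_of_nsq_le_rect _ (Real.sqrt_nonneg _) fun x => ?_
  rw [Real.sq_sqrt (inv_nonneg.mpr (gammaPs_pos (d := d) (a' := a')).1.le), ← Matrix.mulVec_mulVec]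
  exact (nsq_sdiff_le_dirichlet n M ν _).trans (dirichlet_Gps_mulVec_le n M ha' x)

/-- **`‖G′ ∂_ν^*‖ ≤ √(γ′⁻¹)`** (`G′` Hermitian). [folklore] -/
theorem opNorm_Gps_mul_sdiffH_le (ha' : 0 < a') (ν : Fin d) :
    ‖Gps n M a' * (sdiff (fine n M) (n : ℂ) ν)ᴴ‖ ≤ Real.sqrt ((gammaPs d a')⁻¹) := by
  have e : Gps n M a' * (sdiff (fine n M) (n : ℂ) ν)ᴴ = (sdiff (fine n M) (n : ℂ) ν * Gps n M a')ᴴ := by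
    rw [Matrix.conjTranspose_mul, (Gps_isHermitian n M a').eq]
  rw [e, Matrix.l2_opNorm_conjTranspose]
  exact opNorm_sdiff_mul_Gps_le n M ha' ν

/-- `nsq (∂g) = Σ_ν nsq (∂_ν g)` for the gradient `∂ = GradOp` (0-forms → 1-forms). [folklore] -/
theorem nsq_GradOp_mulVec (g : Tor (fine n M) → ℂ) : nsq (GradOp (fine n M) (n : ℂ) *ᵥ g) = dirichlet n M g := by
  unfold nsq dirichlet
  rw [Fintype.sum_prod_type, Finset.sum_comm]
  exact Finset.sum_congr rfl fun ν _ => Finset.sum_congr rfl fun x _ => rfl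

/-- **`‖∂ G′‖ ≤ √(γ′⁻¹)`** for the full gradient `∂ = GradOp`. [folklore] -/
theorem opNorm_GradOp_mul_Gps_le (ha' : 0 < a') : ‖GradOp (fine n M) (n : ℂ) * Gps n M a'‖ ≤ Real.sqrt ((gammaPs d a')⁻¹) := by
  refine opNorm_le_of_nsq_le_rect _ (Real.sqrt_nonneg _) fun x => ?_
  rw [Real.sq_sqrt (inv_nonneg.mpr (gammaPs_pos (d := d) (a' := a')).1.le), ← Matrix.mulVec_mulVec, nsq_GradOp_mulVec]
  exact dirichlet_Gps_mulVec_le n M ha' x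

/-- **`‖∂ G′ ∂^*‖ ≤ 1`**: for `T = ∂G′∂^*` (≥ 0), `nsq (Ty) ≤ re ⟨Ty, y⟩ ≤ √nsq(Ty)·√nsq(y)`. [folklore] -/
theorem opNorm_GradOp_Gps_GradOpH_le (ha' : 0 < a') :
    ‖GradOp (fine n M) (n : ℂ) * Gps n M a' * (GradOp (fine n M) (n : ℂ))ᴴ‖ ≤ 1 := by
  refine opNorm_le_of_nsq_le_rect _ zero_le_one fun y => ?_
  rw [one_pow, one_mul]
  set x := (GradOp (fine n M) (n : ℂ))ᴴ *ᵥ y with hx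
  set g := Gps n M a' *ᵥ x with hg
  have eT : (GradOp (fine n M) (n : ℂ) * Gps n M a' * (GradOp (fine n M) (n : ℂ))ᴴ) *ᵥ y = GradOp (fine n M) (n : ℂ) *ᵥ g := by
    rw [← Matrix.mulVec_mulVec, ← Matrix.mulVec_mulVec]
  rw [eT]
  -- `nsq (∂g) = dirichlet g ≤ re⟨g, x⟩ = re⟨∂g, y⟩ ≤ √nsq(∂g) √nsq(y)`
  have h1 : nsq (GradOp (fine n M) (n : ℂ) *ᵥ g) ≤ (star g ⬝ᵥ x).re := by
    rw [nsq_GradOp_mulVec, re_form_Gps n M ha']; nlinarith [nsq_nonneg (PiS n M *ᵥ g), dirichlet_nonneg n M g]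
  have h2 : star g ⬝ᵥ x = star (GradOp (fine n M) (n : ℂ) *ᵥ g) ⬝ᵥ y := by
    rw [hx]
    exact (Literature.MathematicalPhysics.QuantumFieldTheory.Balaban1983to89.B5Action121.star_mulVec_dotProduct _ _ _).symm
  rw [h2] at h1
  set t := nsq (GradOp (fine n M) (n : ℂ) *ᵥ g) with ht
  have h3 := h1.trans (re_star_dotProduct_le _ y)
  rw [← ht] at h3
  have hst : Real.sqrt t * Real.sqrt t = t := Real.mul_self_sqrt (nsq_nonneg _)
  have hsy : Real.sqrt (nsq y) * Real.sqrt (nsq y) = nsq y := Real.mul_self_sqrt (nsq_nonneg _)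
  by_cases hz : Real.sqrt t = 0
  · have : t = 0 := by rw [← hst, hz, mul_zero]
    rw [this]; exact nsq_nonneg _
  · have hpos : 0 < Real.sqrt t := lt_of_le_of_ne (Real.sqrt_nonneg _) (Ne.symm hz)
    have h4 : Real.sqrt t ≤ Real.sqrt (nsq y) := by
      have : Real.sqrt t * Real.sqrt t ≤ Real.sqrt (nsq y) * Real.sqrt t := by rw [hst]; linarith
      exact le_of_mul_le_mul_right this hpos
    calc t = Real.sqrt t * Real.sqrt t := hst.symm
      _ ≤ Real.sqrt (nsq y) * Real.sqrt (nsq y) := mul_le_mul h4 h4 (Real.sqrt_nonneg _) (Real.sqrt_nonneg _)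
      _ = nsq y := hsy

/-- **`‖∂_ν G′ ∂_μ^*‖ ≤ 1`** for all directions `ν, μ` (a compression of `∂G′∂^*`). [folklore] -/
theorem opNorm_sdiff_Gps_sdiffH_le (ha' : 0 < a') (ν μ : Fin d) :
    ‖sdiff (fine n M) (n : ℂ) ν * Gps n M a' * (sdiff (fine n M) (n : ℂ) μ)ᴴ‖ ≤ 1 := by
  refine opNorm_le_of_nsq_le_rect _ zero_le_one fun y => ?_
  rw [one_pow, one_mul]
  set x := (sdiff (fine n M) (n : ℂ) μ)ᴴ *ᵥ y with hx
  set g := Gps n M a' *ᵥ x with hg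
  have eT : (sdiff (fine n M) (n : ℂ) ν * Gps n M a' * (sdiff (fine n M) (n : ℂ) μ)ᴴ) *ᵥ y = sdiff (fine n M) (n : ℂ) ν *ᵥ g := by
    rw [← Matrix.mulVec_mulVec, ← Matrix.mulVec_mulVec]
  rw [eT]
  -- `nsq (∂_ν g) ≤ dirichlet g ≤ re⟨g, x⟩ = re⟨∂_μ g, y⟩ ≤ √nsq(∂_μ g)·√nsq y`, and the same chain bounds `nsq (∂_μ g)`
  have hD : dirichlet n M g ≤ (star g ⬝ᵥ x).re := by
    rw [re_form_Gps n M ha']; nlinarith [nsq_nonneg (PiS n M *ᵥ g), dirichlet_nonneg n M g]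
  have hν : nsq (sdiff (fine n M) (n : ℂ) ν *ᵥ g) ≤ dirichlet n M g := nsq_sdiff_le_dirichlet n M ν g
  have hμ : nsq (sdiff (fine n M) (n : ℂ) μ *ᵥ g) ≤ dirichlet n M g := nsq_sdiff_le_dirichlet n M μ g
  have h2 : star g ⬝ᵥ x = star (sdiff (fine n M) (n : ℂ) μ *ᵥ g) ⬝ᵥ y := by
    rw [hx]
    exact (Literature.MathematicalPhysics.QuantumFieldTheory.Balaban1983to89.B5Action121.star_mulVec_dotProduct _ _ _).symm
  rw [h2] at hD
  set s := nsq (sdiff (fine n M) (n : ℂ) μ *ᵥ g) with hs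
  set t := nsq (sdiff (fine n M) (n : ℂ) ν *ᵥ g) with ht
  have h3 := hD.trans (re_star_dotProduct_le _ y)
  rw [← hs] at h3
  -- first `s ≤ nsq y`, then `t ≤ √s √(nsq y) ≤ nsq y`
  have hss : Real.sqrt s * Real.sqrt s = s := Real.mul_self_sqrt (nsq_nonneg _)
  have hsy : Real.sqrt (nsq y) * Real.sqrt (nsq y) = nsq y := Real.mul_self_sqrt (nsq_nonneg _)
  have hs_le : Real.sqrt s ≤ Real.sqrt (nsq y) := by
    by_cases hz : Real.sqrt s = 0
    · rw [hz]; exact Real.sqrt_nonneg _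
    · have hpos : 0 < Real.sqrt s := lt_of_le_of_ne (Real.sqrt_nonneg _) (Ne.symm hz)
      have : Real.sqrt s * Real.sqrt s ≤ Real.sqrt (nsq y) * Real.sqrt s := by rw [hss]; linarith
      exact le_of_mul_le_mul_right this hpos
  calc t ≤ Real.sqrt s * Real.sqrt (nsq y) := by linarith
    _ ≤ Real.sqrt (nsq y) * Real.sqrt (nsq y) := mul_le_mul_of_nonneg_right hs_le (Real.sqrt_nonneg _)
    _ = nsq y := hsy

end Bounds

end Summit.QuantumFields.BalabanUV.T4Continuum.ScalarAveragedPropagator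

end
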